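import Literature.NumberTheory.Automorphic.AdelicHeightSumAffineLine
import HarnessLib

/-!
# The local heights of `(1, b)` and the classical height majorant `Π_v max(1, |b|_v)` of the affine line

Topic `NumberTheory/Automorphic`; namespace `Literature.NumberTheory.Automorphic` (sequel of ★ `AdelicVectorHeight`,
★ `AdelicHeightZetaConvergence`).  KERNEL only: proved theorems, no definition, no named fact, no `sorry`.

For a number field `K`, `b ∈ K` and the rational vector `(1, b) ∈ K²` read in `𝔸_K²` (`ratVec K ![1, b]`), the Godement–Garrett local
heights of ★ `AdelicVectorHeight` are EXPLICIT:

* `vecFinHeight_ratVec_vecCons_one` — at a finite place `v`: `h_v(1, b) = max(1, |b|_v)`;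
* `vecArchNorm_ratVec_vecCons_one` — at an infinite place `w`: the Euclidean norm is `√(1 + |b|_w²)`, squeezed between
  `max(1, |b|_w)` and `√2 · max(1, |b|_w)` (`max_one_le_vecArchNorm_ratVec_vecCons_one`, `vecArchNorm_ratVec_vecCons_one_le`);
* hence the GLOBAL height `h(1, b)` is squeezed between the classical height of the point `[1 : b] ∈ ℙ¹(K)`,
  `H(b) := Π_{w ∣ ∞} max(1, |b|_w)^{mult w} · Π_{v ∤ ∞} max(1, |b|_v)`, and `√2^{[K:ℚ]} · H(b)`
  (`classicalHeight_le_vecHeight_ratVec_vecCons_one`, `vecHeight_ratVec_vecCons_one_le`; `H(b)` is written out, no definition);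
* so `H(b)^{−τ} ≤ (√2^{[K:ℚ]})^τ · h(1, b)^{−τ}` (`classicalHeight_rpow_neg_le`) and **`Σ_{b ∈ K} H(b)^{−τ} < ∞` for `τ > 2`**
  (`summable_classicalHeight_rpow_neg`, from ★ `summable_vecHeight_rpow_neg` on `ℙ¹(K)`), with the comparison test
  `‖f b‖ ≤ C · H(b)^{−τ} ⇒ Summable f ∧ Σ ‖f b‖ ≤ C · Σ H(b)^{−τ}` (`summable_of_norm_le_mul_classicalHeight_rpow_neg`).

This is the shape in which local Gauss-transform ∕ Whittaker bounds `|F_v(b)| ≤ c_v · max(1, |b|_v)^{−N}` (with `c_v = 1` at almost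
all places) are multiplied over the places and summed over `b ∈ F` in Weil's convergence proof for the rank-one Siegel–Eisenstein
series ([Weil1965, n° 40–41, Thm. 1]: range `N > 2`; [Garrett2018, §2.2 Thm. 2.2.2, §3.3]).  Cell `hodgecm-mathlib`, FLOOR 0, E-2
desk, crux item H413, child line `Cruxes/H413/Lines/F0_E2SiegelWeilWeilRange.lean`, piece «SW2 (unif)» (U3′).  HC_CM is proved only
modulo the 7 printed citations until rung 0 closes; this file is unconditional and touches no binder.

## References
* [Garrett2018] P. Garrett, *Modern Analysis of Automorphic Forms by Example* (2018), §2.2 (PDF pp. 81–84), Thm. 2.2.2, §3.3.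
* [Weil1965] A. Weil, *Sur la formule de Siegel dans la théorie des groupes classiques*, Acta Math. 113 (1965), n° 40–41, Thm. 1.
* [BombieriGubler2006] E. Bombieri, W. Gubler, *Heights in Diophantine Geometry*, CUP 2006, §1.5 (the Weil height of `[1 : b]`).
-/

set_option autoImplicit false

noncomputable section

open scoped NNReal Matrix
open NumberField IsDedekindDomain Matrix

namespace Literature.NumberTheory.Automorphic

section Local

variable (K : Type) [Field K] [NumberField K]

/-- the coordinates of `ratVec K ![1, b]` at a finite place. [folklore] -/
private theorem ratVec_vecCons_one_snd (b : K) (v : HeightOneSpectrum (𝓞 K)) :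
    ((ratVec K (![1, b] : Fin (1 + 1) → K) 0).2 v = 1) ∧
      ((ratVec K (![1, b] : Fin (1 + 1) → K) 1).2 v = ((b : K) : v.adicCompletion K)) := by
  constructor
  · change (algebraMap K (AdeleRing (𝓞 K) K) ((![1, b] : Fin (1 + 1) → K) 0)).2 v = 1
    rw [Matrix.cons_val_zero, map_one]
    rfl
  · rfl

/-- the coordinates of `ratVec K ![1, b]` at an infinite place. [folklore] -/
private theorem ratVec_vecCons_one_fst (b : K) (w : InfinitePlace K) :
    ((ratVec K (![1, b] : Fin (1 + 1) → K) 0).1 w = 1) ∧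
      ((ratVec K (![1, b] : Fin (1 + 1) → K) 1).1 w = ((b : K) : w.Completion)) := by
  constructor
  · change (algebraMap K (AdeleRing (𝓞 K) K) ((![1, b] : Fin (1 + 1) → K) 0)).1 w = 1
    rw [Matrix.cons_val_zero, map_one]
    rfl
  · rfl

/-- **`h_v(1, b) = max(1, |b|_v)` at a finite place `v`.** [cite: Garrett2018, §2.2 (PDF p. 81)] [cite: BombieriGubler2006, §1.5] -/
theorem vecFinHeight_ratVec_vecCons_one (b : K) (v : HeightOneSpectrum (𝓞 K)) :
    vecFinHeight K v (ratVec K (![1, b] : Fin (1 + 1) → K)) = max 1 ‖((b : K) : v.adicCompletion K)‖₊ := by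
  obtain ⟨h0, h1⟩ := ratVec_vecCons_one_snd K b v
  refine le_antisymm (vecFinHeight_le fun i => ?_) (max_le ?_ ?_)
  · fin_cases i
    · change ‖(ratVec K (![1, b] : Fin (1 + 1) → K) 0).2 v‖₊ ≤ _
      rw [h0, nnnorm_one]
      exact le_max_left _ _
    · change ‖(ratVec K (![1, b] : Fin (1 + 1) → K) 1).2 v‖₊ ≤ _
      rw [h1]
      exact le_max_right _ _
  · have h := nnnorm_snd_apply_le_vecFinHeight v (ratVec K (![1, b] : Fin (1 + 1) → K)) 0
    rwa [h0, nnnorm_one] at h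
  · have h := nnnorm_snd_apply_le_vecFinHeight v (ratVec K (![1, b] : Fin (1 + 1) → K)) 1
    rwa [h1] at h

/-- **The Euclidean norm of `(1, b)` at an infinite place `w` is `√(1 + |b|_w²)`.** [cite: Garrett2018, §2.2 (PDF p. 81)] -/
theorem vecArchNorm_ratVec_vecCons_one (b : K) (w : InfinitePlace K) :
    vecArchNorm K w (ratVec K (![1, b] : Fin (1 + 1) → K)) = NNReal.sqrt (1 + ‖((b : K) : w.Completion)‖₊ ^ 2) := by
  obtain ⟨h0, h1⟩ := ratVec_vecCons_one_fst K b w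
  rw [vecArchNorm, Fin.sum_univ_two, h0, h1, nnnorm_one, one_pow]

/-- `max(1, |b|_w) ≤ √(1 + |b|_w²)`. [cite: BombieriGubler2006, §1.5] -/
theorem max_one_le_vecArchNorm_ratVec_vecCons_one (b : K) (w : InfinitePlace K) :
    max 1 ‖((b : K) : w.Completion)‖₊ ≤ vecArchNorm K w (ratVec K (![1, b] : Fin (1 + 1) → K)) := by
  rw [vecArchNorm_ratVec_vecCons_one]
  refine max_le ?_ ?_
  · calc (1 : ℝ≥0) = NNReal.sqrt 1 := NNReal.sqrt_one.symm
      _ ≤ _ := NNReal.sqrt_le_sqrt.mpr le_self_add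
  · calc ‖((b : K) : w.Completion)‖₊ = NNReal.sqrt (‖((b : K) : w.Completion)‖₊ ^ 2) := (NNReal.sqrt_sq _).symm
      _ ≤ _ := NNReal.sqrt_le_sqrt.mpr le_add_self

/-- `√(1 + |b|_w²) ≤ √2 · max(1, |b|_w)`. [cite: BombieriGubler2006, §1.5] -/
theorem vecArchNorm_ratVec_vecCons_one_le (b : K) (w : InfinitePlace K) :
    vecArchNorm K w (ratVec K (![1, b] : Fin (1 + 1) → K)) ≤ NNReal.sqrt 2 * max 1 ‖((b : K) : w.Completion)‖₊ := by
  rw [vecArchNorm_ratVec_vecCons_one]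
  set t : ℝ≥0 := ‖((b : K) : w.Completion)‖₊
  have h : 1 + t ^ 2 ≤ 2 * (max 1 t) ^ 2 := by
    have h1 : (1 : ℝ≥0) ≤ (max 1 t) ^ 2 := by
      calc (1 : ℝ≥0) = 1 ^ 2 := (one_pow 2).symm
        _ ≤ (max 1 t) ^ 2 := pow_le_pow_left' (le_max_left _ _) 2
    have h2 : t ^ 2 ≤ (max 1 t) ^ 2 := pow_le_pow_left' (le_max_right _ _) 2
    calc 1 + t ^ 2 ≤ (max 1 t) ^ 2 + (max 1 t) ^ 2 := add_le_add h1 h2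
      _ = 2 * (max 1 t) ^ 2 := (two_mul _).symm
  calc NNReal.sqrt (1 + t ^ 2) ≤ NNReal.sqrt (2 * (max 1 t) ^ 2) := NNReal.sqrt_le_sqrt.mpr h
    _ = NNReal.sqrt 2 * max 1 t := by rw [NNReal.sqrt_mul, NNReal.sqrt_sq]

/-- **Lower bound**: the classical height of `[1 : b]` is at most the Godement–Garrett height of `(1, b)`:
`Π_w max(1, |b|_w)^{mult w} · Π_v max(1, |b|_v) ≤ h(1, b)`. [cite: Garrett2018, §2.2 (PDF p. 81)] [cite: BombieriGubler2006, §1.5] -/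
theorem classicalHeight_le_vecHeight_ratVec_vecCons_one (b : K) :
    (∏ w : InfinitePlace K, (max 1 ‖((b : K) : w.Completion)‖₊) ^ w.mult) *
        ∏ᶠ v : HeightOneSpectrum (𝓞 K), max 1 ‖((b : K) : v.adicCompletion K)‖₊ ≤
      vecHeight K (ratVec K (![1, b] : Fin (1 + 1) → K)) := by
  rw [vecHeight]
  refine mul_le_mul' (Finset.prod_le_prod' fun w _ => ?_) (le_of_eq (finprod_congr fun v => ?_))
  · exact pow_le_pow_left' (max_one_le_vecArchNorm_ratVec_vecCons_one K b w) _
  · exact (vecFinHeight_ratVec_vecCons_one K b v).symm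

/-- **Upper bound**: `h(1, b) ≤ √2^{[K:ℚ]} · Π_w max(1, |b|_w)^{mult w} · Π_v max(1, |b|_v)`.
[cite: Garrett2018, §2.2 (PDF p. 81)] [cite: BombieriGubler2006, §1.5] -/
theorem vecHeight_ratVec_vecCons_one_le (b : K) :
    vecHeight K (ratVec K (![1, b] : Fin (1 + 1) → K)) ≤
      NNReal.sqrt 2 ^ Module.finrank ℚ K *
        ((∏ w : InfinitePlace K, (max 1 ‖((b : K) : w.Completion)‖₊) ^ w.mult) *
          ∏ᶠ v : HeightOneSpectrum (𝓞 K), max 1 ‖((b : K) : v.adicCompletion K)‖₊) := by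
  rw [vecHeight, ← mul_assoc]
  refine mul_le_mul' ?_ (le_of_eq (finprod_congr fun v => vecFinHeight_ratVec_vecCons_one K b v))
  calc ∏ w : InfinitePlace K, vecArchNorm K w (ratVec K (![1, b] : Fin (1 + 1) → K)) ^ w.mult
      ≤ ∏ w : InfinitePlace K, (NNReal.sqrt 2 * max 1 ‖((b : K) : w.Completion)‖₊) ^ w.mult :=
        Finset.prod_le_prod' fun w _ => pow_le_pow_left' (vecArchNorm_ratVec_vecCons_one_le K b w) _
    _ = NNReal.sqrt 2 ^ Module.finrank ℚ K * ∏ w : InfinitePlace K, (max 1 ‖((b : K) : w.Completion)‖₊) ^ w.mult := by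
        simp_rw [mul_pow]
        rw [Finset.prod_mul_distrib, Finset.prod_pow_eq_pow_sum, InfinitePlace.sum_mult_eq]

/-- the classical height is `≥ 1`, in particular positive. [cite: BombieriGubler2006, §1.5] -/
theorem one_le_classicalHeight (b : K) :
    1 ≤ (∏ w : InfinitePlace K, (max 1 ‖((b : K) : w.Completion)‖₊) ^ w.mult) *
        ∏ᶠ v : HeightOneSpectrum (𝓞 K), max 1 ‖((b : K) : v.adicCompletion K)‖₊ := by
  refine one_le_mul (Finset.one_le_prod' fun w _ => one_le_pow_of_one_le' (le_max_left _ _) _) ?_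
  exact one_le_finprod' fun v => le_max_left _ _

end Local

/-! ## The classical height majorant is summable with exponent `τ > 2` -/

section Sum

variable (K : Type) [Field K] [NumberField K]

/-- **`H(b)^{−τ} ≤ (√2^{[K:ℚ]})^τ · h(1, b)^{−τ}`** for `τ ≥ 0`. [cite: Garrett2018, §2.2 Thm. 2.2.2] -/
theorem classicalHeight_rpow_neg_le (b : K) {τ : ℝ} (hτ : 0 ≤ τ) :
    ((((∏ w : InfinitePlace K, (max 1 ‖((b : K) : w.Completion)‖₊) ^ w.mult) *
        ∏ᶠ v : HeightOneSpectrum (𝓞 K), max 1 ‖((b : K) : v.adicCompletion K)‖₊ : ℝ≥0) : ℝ)) ^ (-τ) ≤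
      ((NNReal.sqrt 2 ^ Module.finrank ℚ K : ℝ≥0) : ℝ) ^ τ *
        ((vecHeight K (ratVec K (![1, b] : Fin (1 + 1) → K)) : ℝ≥0) : ℝ) ^ (-τ) := by
  set a : ℝ := (((∏ w : InfinitePlace K, (max 1 ‖((b : K) : w.Completion)‖₊) ^ w.mult) *
        ∏ᶠ v : HeightOneSpectrum (𝓞 K), max 1 ‖((b : K) : v.adicCompletion K)‖₊ : ℝ≥0) : ℝ) with ha
  set h : ℝ := ((vecHeight K (ratVec K (![1, b] : Fin (1 + 1) → K)) : ℝ≥0) : ℝ) with hh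
  set c : ℝ := ((NNReal.sqrt 2 ^ Module.finrank ℚ K : ℝ≥0) : ℝ) with hc
  have ha1 : 1 ≤ a := by
    rw [ha, ← NNReal.coe_one, NNReal.coe_le_coe]
    exact one_le_classicalHeight K b
  have ha0 : 0 < a := lt_of_lt_of_le one_pos ha1
  have hh0 : 0 < h := lt_of_lt_of_le ha0 (by
    rw [ha, hh, NNReal.coe_le_coe]
    exact classicalHeight_le_vecHeight_ratVec_vecCons_one K b)
  have hc0 : 0 ≤ c := NNReal.coe_nonneg _
  -- `h ≤ c a`
  have hle : h ≤ c * a := by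
    rw [ha, hh, hc, ← NNReal.coe_mul, NNReal.coe_le_coe]
    exact vecHeight_ratVec_vecCons_one_le K b
  have hinv : a⁻¹ ≤ c * h⁻¹ := by
    rw [inv_le_iff_one_le_mul₀ ha0, mul_assoc, mul_comm h⁻¹ a, ← mul_assoc, ← div_eq_mul_inv, one_le_div hh0]
    exact hle
  rw [Real.rpow_neg ha0.le, Real.rpow_neg hh0.le, ← Real.inv_rpow ha0.le, ← Real.inv_rpow hh0.le,
    ← Real.mul_rpow hc0 (inv_nonneg.2 hh0.le)]
  exact Real.rpow_le_rpow (inv_nonneg.2 ha0.le) hinv hτ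

/-- **THE CLASSICAL HEIGHT ZETA SUM OF THE AFFINE LINE CONVERGES FOR `τ > 2`**:
`Σ_{b ∈ K} (Π_w max(1, |b|_w)^{mult w} · Π_v max(1, |b|_v))^{−τ} < ∞` (Schanuel: `#{b : H(b) ≤ X} ≍ X²`).
[cite: Garrett2018, §3.3; Weil1965, n° 41 Thm. 1] -/
theorem summable_classicalHeight_rpow_neg {τ : ℝ} (hτ : 2 < τ) :
    Summable fun b : K =>
      ((((∏ w : InfinitePlace K, (max 1 ‖((b : K) : w.Completion)‖₊) ^ w.mult) *
          ∏ᶠ v : HeightOneSpectrum (𝓞 K), max 1 ‖((b : K) : v.adicCompletion K)‖₊ : ℝ≥0) : ℝ)) ^ (-τ) := by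
  have hτ0 : 0 ≤ τ := by linarith
  have hs := (summable_vecHeight_vecCons_one_rpow_neg K 1 hτ).mul_left
    (((NNReal.sqrt 2 ^ Module.finrank ℚ K : ℝ≥0) : ℝ) ^ τ)
  refine Summable.of_nonneg_of_le (fun b => Real.rpow_nonneg (NNReal.coe_nonneg _) _) (fun b => ?_) hs
  have h := classicalHeight_rpow_neg_le K b hτ0
  rw [Units.val_one, Matrix.vecMul_one]
  exact h

variable {E : Type*} [NormedAddCommGroup E] [CompleteSpace E]

/-- **Comparison test against the classical height majorant**: `‖f b‖ ≤ C · H(b)^{−τ}` for all `b ∈ K`, `τ > 2` ⇒ `f` summable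
and `Σ_b ‖f b‖ ≤ C · Σ_b H(b)^{−τ}` — the form in which per-place bounds `c_v · max(1, |b|_v)^{−τ}` are summed over `b ∈ K`.
[cite: Weil1965, n° 41 Thm. 1; Garrett2018, §3.3] -/
theorem summable_of_norm_le_mul_classicalHeight_rpow_neg {τ : ℝ} (hτ : 2 < τ) (C : ℝ) (f : K → E)
    (hf : ∀ b, ‖f b‖ ≤ C * ((((∏ w : InfinitePlace K, (max 1 ‖((b : K) : w.Completion)‖₊) ^ w.mult) *
        ∏ᶠ v : HeightOneSpectrum (𝓞 K), max 1 ‖((b : K) : v.adicCompletion K)‖₊ : ℝ≥0) : ℝ)) ^ (-τ)) :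
    Summable f ∧ ∑' b, ‖f b‖ ≤ C * ∑' b : K,
      ((((∏ w : InfinitePlace K, (max 1 ‖((b : K) : w.Completion)‖₊) ^ w.mult) *
          ∏ᶠ v : HeightOneSpectrum (𝓞 K), max 1 ‖((b : K) : v.adicCompletion K)‖₊ : ℝ≥0) : ℝ)) ^ (-τ) := by
  have hs := (summable_classicalHeight_rpow_neg K hτ).mul_left C
  have hsum : Summable f := Summable.of_norm_bounded hs hf
  refine ⟨hsum, ?_⟩
  rw [← tsum_mul_left]
  exact Summable.tsum_le_tsum hf (Summable.of_nonneg_of_le (fun b => norm_nonneg _) hf hs) hs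

end Sum

end Literature.NumberTheory.Automorphic

end
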